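import Mathlib
import Summits.ValiantsHypothesis.ValiantsHypothesis.Theorems.GrenetZeonTwoDimCoefficientsScalingFirstOrderRank

/-!
# Crux `GrenetZeon.TwoDimCoefficients` (stmt-ValiantsHypothesis-8062), stub `stub_dualUnipotent`:
# scaling-closure — RANK FACTORISATION and `det(1 − t·M)` BEYOND THE RANK (lemmas F2 / F3b-core of EIGHTEENTH-HAND.md)

Bricks for the numerator-perturbation argument (memo EIGHTEENTH-HAND.md §NEW), all generic linear algebra:

* `exists_rank_factorization` — over a field, `M = U·V` through `Fin (rank M)` with a LEFT inverse of `U` and a RIGHT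
  inverse of `V` (so the compression `X ↦ V·X·U` is onto `r × r` matrices).
* `charpolyRev_mul_comm'` — `det(1 − t·UV) = det(1 − t·VU)` for rectangular `U, V` (✓ `Matrix.det_one_sub_mul_comm`);
  `natDegree_charpolyRev_le` — `deg_t det(1 − t·N) ≤` size of `N`.
* ★ `coeff_charpolyRev_eq_zero_of_rank_lt` — over a field, `[t^j] det(1 − t·M) = 0` for `j > rank M`;
  `charpolyRev_map`, and the polynomial-identity form ★ `coeff_charpolyRev_eq_zero_of_forall_rank_lt` for a matrix
  over `ℂ[z]` whose values have rank `< j` everywhere (so the top companions `[D_k]_{kn} = c^{1−k}σ_k(N^{n−1}L)` of an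
  index-`n` pencil vanish for `k > max_z rank N(z)^{n−1}`).

HONEST FRAMING: generic linear algebra; the stub `DualUnipotentBound`, both cruxes (stmt-8062, stmt-24318) and
`VP ≠ VNP` remain open.

References: folklore.
-/

-- single-conjunct layout `Summits/ValiantsHypothesis/ValiantsHypothesis`: the duplicated namespace
-- component is mandated by the tree.
set_option linter.dupNamespace false
set_option autoImplicit false

noncomputable section

namespace Summit.ValiantsHypothesis.ValiantsHypothesis.Theorems.GrenetZeonTwoDimCoefficients.ScalingClosure

open Matrix Polynomial

section Factorization

variable {F : Type*} [Field F] {p q : Type*} [Fintype p] [Fintype q] [DecidableEq p] [DecidableEq q]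

/-- **Rank factorisation with one-sided inverses.**  Over a field, every `M` factors as `M = U·V` through
`Fin (rank M)`, with `Q·U = 1` and `V·P = 1` for suitable `Q, P`. [folklore] -/
theorem exists_rank_factorization (M : Matrix p q F) :
    ∃ (U : Matrix p (Fin M.rank) F) (V : Matrix (Fin M.rank) q F) (Q : Matrix (Fin M.rank) p F)
      (P : Matrix q (Fin M.rank) F), M = U * V ∧ Q * U = 1 ∧ V * P = 1 := by
  set f : (q → F) →ₗ[F] (p → F) := M.mulVecLin with hf
  set W : Submodule F (p → F) := LinearMap.range f with hW
  have hWr : Module.finrank F W = M.rank := rfl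
  set b : Module.Basis (Fin M.rank) F W := Module.finBasisOfFinrankEq F W hWr with hb
  set e : W ≃ₗ[F] (Fin M.rank → F) := b.equivFun with he
  set ι : (Fin M.rank → F) →ₗ[F] (p → F) := W.subtype.comp e.symm.toLinearMap with hι
  set g : (q → F) →ₗ[F] (Fin M.rank → F) := e.toLinearMap.comp f.rangeRestrict with hg
  have hfac : f = ι.comp g := by
    apply LinearMap.ext; intro x
    simp [hι, hg]
  have hι_inj : LinearMap.ker ι = ⊥ := by
    rw [hι, LinearMap.ker_comp, Submodule.ker_subtype, Submodule.comap_bot, LinearEquiv.ker]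
  have hg_surj : LinearMap.range g = ⊤ := by
    rw [hg, LinearMap.range_comp, LinearMap.range_rangeRestrict, Submodule.map_top, LinearEquiv.range]
  obtain ⟨L, hL⟩ := ι.exists_leftInverse_of_injective hι_inj
  obtain ⟨Rg, hRg⟩ := g.exists_rightInverse_of_surjective hg_surj
  refine ⟨LinearMap.toMatrix' ι, LinearMap.toMatrix' g, LinearMap.toMatrix' L, LinearMap.toMatrix' Rg, ?_, ?_, ?_⟩
  · rw [← LinearMap.toMatrix'_comp, ← hfac, hf, ← Matrix.toLin'_apply', LinearMap.toMatrix'_toLin']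
  · rw [← LinearMap.toMatrix'_comp, hL, LinearMap.toMatrix'_id]
  · rw [← LinearMap.toMatrix'_comp, hRg, LinearMap.toMatrix'_id]

end Factorization

section CharpolyRev

variable {R : Type*} [CommRing R] {p q : Type*} [Fintype p] [Fintype q] [DecidableEq p] [DecidableEq q]

/-- `det(1 − t·UV) = det(1 − t·VU)` for rectangular `U, V`. [folklore] -/
theorem charpolyRev_mul_comm' (U : Matrix p q R) (V : Matrix q p R) :
    (U * V).charpolyRev = (V * U).charpolyRev := by
  rw [Matrix.charpolyRev, Matrix.charpolyRev, Matrix.map_mul, Matrix.map_mul, ← Matrix.smul_mul,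
    Matrix.det_one_sub_mul_comm, Matrix.mul_smul]

/-- `deg_t det(1 − t·N) ≤` the size of `N`. [folklore] -/
theorem natDegree_charpolyRev_le (N : Matrix q q R) : N.charpolyRev.natDegree ≤ Fintype.card q := by
  have h : (1 : Matrix q q R[X]) - (X : R[X]) • N.map C = (X : R[X]) • (-N).map C + (1 : Matrix q q R).map C := by
    ext i j
    simp only [Matrix.sub_apply, Matrix.add_apply, Matrix.smul_apply, Matrix.map_apply, Matrix.neg_apply,
      Matrix.one_apply, smul_eq_mul, map_neg, mul_neg]
    split_ifs
    · rw [map_one]; ring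
    · rw [map_zero]; ring
  rw [Matrix.charpolyRev, h]
  exact Polynomial.natDegree_det_X_add_C_le _ _

/-- `charpolyRev` commutes with ring maps. [folklore] -/
theorem charpolyRev_map {S : Type*} [CommRing S] (f : R →+* S) (N : Matrix q q R) :
    (N.map f).charpolyRev = N.charpolyRev.map f := by
  rw [Matrix.charpolyRev, Matrix.charpolyRev, ← Polynomial.coe_mapRingHom, RingHom.map_det, RingHom.mapMatrix_apply]
  congr 1
  ext i j
  rw [Matrix.map_apply, Matrix.sub_apply, Matrix.sub_apply, Matrix.smul_apply, Matrix.smul_apply,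
    Matrix.map_apply, Matrix.map_apply, Matrix.map_apply, map_sub, smul_eq_mul, smul_eq_mul, map_mul,
    Polynomial.coe_mapRingHom, Polynomial.map_X, Polynomial.map_C, Matrix.one_apply, Matrix.one_apply]
  split_ifs <;> simp

end CharpolyRev

section RankBound

variable {F : Type*} [Field F] {p : Type*} [Fintype p] [DecidableEq p]

/-- ★ **`det(1 − t·M)` has no terms beyond the rank**: over a field, `[t^j] det(1 − t·M) = 0` for `j > rank M`.
[folklore] -/
theorem coeff_charpolyRev_eq_zero_of_rank_lt (M : Matrix p p F) {j : ℕ} (hj : M.rank < j) :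
    M.charpolyRev.coeff j = 0 := by
  obtain ⟨U, V, -, -, hUV, -, -⟩ := exists_rank_factorization M
  rw [hUV, charpolyRev_mul_comm']
  refine Polynomial.coeff_eq_zero_of_natDegree_lt ((natDegree_charpolyRev_le _).trans_lt ?_)
  rw [Fintype.card_fin]
  exact hj

/-- ★ **Polynomial-identity form.**  A matrix `W` over `ℂ[z]` whose values `W(z)` have rank `< j` at every point has
`[t^j] det(1 − t·W) = 0` in `ℂ[z]`. [folklore] -/
theorem coeff_charpolyRev_eq_zero_of_forall_rank_lt {σ : Type*} (W : Matrix p p (MvPolynomial σ ℂ)) {j : ℕ}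
    (h : ∀ z : σ → ℂ, (W.map (MvPolynomial.eval z)).rank < j) : W.charpolyRev.coeff j = 0 := by
  apply MvPolynomial.funext
  intro z
  rw [map_zero, ← Polynomial.coeff_map, ← charpolyRev_map]
  exact coeff_charpolyRev_eq_zero_of_rank_lt _ (h z)

end RankBound

end Summit.ValiantsHypothesis.ValiantsHypothesis.Theorems.GrenetZeonTwoDimCoefficients.ScalingClosure

end
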